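import Literature.MathematicalPhysics.QuantumFieldTheory.ConformalBootstrap3D.PointKernelK34L505Data
import Literature.MathematicalPhysics.QuantumFieldTheory.ConformalBootstrap3D.PointKernelK34L505Segs

/-!
# K34L505 certificate, kernel block file H8: head segments (monotone coefficient rule; block checker `PCert.hBlockOK` of `PointKernel`, soundness `PCert.hBlockOK_sound`), segments `177 ≤ i < 193`

`decide` by kernel reduction (no `native_decide`, no extra axioms) on the literal data of
`PointKernelK34L505Data`, on the certificate itself (full `s`-width) or on its piece certificates
`pcP_i = certK34L505.withS σ_i σ_(i+1) …` (the cell numbers on an `s`-piece; assembled by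
`CellFactS_of_pieces`).  Estimated kernel time 259 s (5 theorems).
-/

set_option maxRecDepth 100000
set_option maxHeartbeats 0

namespace Literature.MathematicalPhysics.QuantumFieldTheory.ConformalBootstrap3D.PointKernelK34L505

open Literature.MathematicalPhysics.QuantumFieldTheory.ConformalBootstrap3D.PointKernel

/-- segment `[177, 178)` of `hsegsK34L505` passes the kernel evaluator (≈44 s of kernel work). [folklore] -/
theorem hBlock_177 : certK34L505.hBlockOK hsegsK34L505 177 178 JHK34L505 = true := by
  decide +kernel

/-- segment `[178, 179)` of `hsegsK34L505` passes the kernel evaluator (≈40 s of kernel work). [folklore] -/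
theorem hBlock_178 : certK34L505.hBlockOK hsegsK34L505 178 179 JHK34L505 = true := by
  decide +kernel

/-- segment `[179, 180)` of `hsegsK34L505` passes the kernel evaluator (≈44 s of kernel work). [folklore] -/
theorem hBlock_179 : certK34L505.hBlockOK hsegsK34L505 179 180 JHK34L505 = true := by
  decide +kernel

/-- segments `[180, 182)` of `hsegsK34L505` pass the kernel evaluator (≈58 s of kernel work). [folklore] -/
theorem hBlock_180 : certK34L505.hBlockOK hsegsK34L505 180 182 JHK34L505 = true := by
  decide +kernel

/-- segments `[182, 193)` of `hsegsK34L505` pass the kernel evaluator (≈25 s of kernel work). [folklore] -/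
theorem hBlock_182 : certK34L505.hBlockOK hsegsK34L505 182 193 JHK34L505 = true := by
  decide +kernel

end Literature.MathematicalPhysics.QuantumFieldTheory.ConformalBootstrap3D.PointKernelK34L505
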